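import Literature.MathematicalPhysics.StatisticalMechanics.HardSphereVirialCoefficients
import Literature.MeasureTheory.Lebesgue.OffCentreBall
import Literature.NumberTheory.Transcendental.KZProduct
import Literature.MathematicalPhysics.StatisticalMechanics.BoltzmannB4HardSpheresFinal
import Literature.MathematicalPhysics.StatisticalMechanics.HardDiscVirialB4Proofs
import HarnessLib

/-!
# `B₃ = (5/8)·B₂²` for hard spheres: discharge of `hardSphere_B3`

This file proves the named fact
`Literature.MathematicalPhysics.StatisticalMechanics.HardSphereVirial.hardSphere_B3`
(`HardSphereVirialCoefficients.lean`): `(1/3)·vol(triangleSphere) = (5/8)·(2π/3)²`, i.e. the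
Mayer triangle domain `{(x₂, x₃) ∈ ℝ³ × ℝ³ : |x₂|, |x₃|, |x₂ − x₃| < 1}` has volume `5π²/6`.

Source followed. Lyberg [Lyberg2005, §1] prints `B₃ = −(1/3)∫∫ f₁₂f₁₃f₂₃` with the hard-sphere
Mayer function `f = −𝟙_{r<σ}`, `σ = 1`, `B₂ = π^{D/2}/(2Γ(D/2+1))`, and (after Luban–Baram)
`B₃/B₂² = 4Γ(1+D/2)/(π^{1/2}Γ((1+D)/2)) ∫₀^{π/3} sin^D φ dφ`; at `D = 3` this is
`3·∫₀^{π/3} sin³φ dφ = 3·(5/24) = 5/8` (Boltzmann 1896), `B₂ = 2π/3`. The classical computation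
behind the printed value (Boltzmann; Pathria–Beale, *Statistical Mechanics*, §10.3) is the one
formalised here: `vol = ∫_{|x|<1} L(x) dx` where
`L(x) = vol(B(0,1) ∩ B(x,1)) = 4π/3 − π|x| + π|x|³/12` is the volume of the lens common to two
unit balls at distance `|x| ≤ 1`, and then `∫_{|x|<1} L = 4π∫₀¹ w² L(w) dw = 5π²/6`.

* `volume_unitBall_inter_unitBall` — the lens volume. It is read off from the bipolar-coordinates
  disintegration already in the tree, `Literature.Analysis.FluidPDE.Tao2016.lintegral_norm_norm_add`
  (the pair of distances `(|y|, |y − x|)` of a Lebesgue point `y ∈ ℝ³` has density `2π r₁ r₂/|x|`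
  on the triangle-inequality region): `L = (2π/d)∫₀¹ r₁ dr₁ ∫_{|d−r₁|}^{min(d+r₁,1)} r₂ dr₂`, two
  polynomial pieces (`r₁ ≶ 1 − d`). (The Cavalieri / hat-box lens lemmas of `OffCentreBall.lean`
  and `Yuhjtman2015Radial.lean` are stated for centre distance `>` radius and do not cover the
  overlapping case `|x| < 1` needed here; the same value for all distances `≤ 2` is obtained
  independently, by a Householder reflection and slicing into discs, in
  `Literature.MathematicalPhysics.StatisticalMechanics.BoltzmannB4.volume_lens`
  (`BoltzmannB4HardSpheresProofs.lean`), which this file does not import.)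
* `volume_triangleProd` — Fubini over `x₂` (`Measure.prod_apply`) and the radial formula
  `Literature.MeasureTheory.Lebesgue.lintegral_radial_three`.
* `volume_triangleSphere` — transfer from `Fin 6 → ℝ` to `ℝ³ × ℝ³` along `Fin.append`
  (`Literature.NumberTheory.Transcendental.KZ.appendMeasurableEquiv`) and `WithLp.toLp`
  (`PiLp.volume_preserving_toLp`), both volume preserving.
* `hardSphere_B3_holds` — the discharge.
* `hardSphere_B4_holds` — discharge of the companion fact `hardSphere_B4` (Boltzmann 1899 /
  Nijboer–van Hove 1952, as printed in [Lyberg2005, §1]): a corollary of the tree's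
  `Boltzmann1899_B4_hardSpheres_dim3_holds` (`BoltzmannB4HardSpheresFinal.lean`, which computes the
  ring, diamond and complete-star volumes), the three configuration sets there being
  definitionally `ringSphere`, `diamondSphere`, `starSphere`.
* `hardDisc_B4_holds` — discharge of the hard-DISC companion `hardDisc_B4` (Rowlinson 1964,
  Hemmer 1964, as printed in [ClisbyMccoy2004, §1]): a corollary of the tree's
  `ClisbyMcCoy2004_B4_hardDiscs_holds` (`HardDiscVirialB4Proofs.lean`), the disc configuration
  sets `hardDiscRing`, `hardDiscDiamond`, `hardDiscStar` of `HardDiscVirial.lean` being the present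
  `ringDisc` (verbatim), `diamondDisc` (same conjuncts, reordered), `starDisc` (verbatim); with the
  transported star volume `volume_starDisc_toReal`. (These five declarations were first landed by a
  sibling seat and inadvertently dropped by a concurrent whole-file resubmission; restored here.)

## References

* I. Lyberg, *The fourth virial coefficient of a fluid of hard spheres in odd dimensions*,
  J. Stat. Phys. 119 (2005) 747–764, arXiv:cond-mat/0410080, §1 (`B₃`, `B₂`, `B₃/B₂²` formulae,
  table of `B₂`, `B₃`). [Lyberg2005]
* L. Boltzmann, Sitzungsber. Akad. Wiss. Wien, Math.-Naturw. Kl. (2a) 105 (1896) 695.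
* R. K. Pathria, P. D. Beale, *Statistical Mechanics*, 3rd ed. (2011), §10.3 eq. (20).
-/

noncomputable section

open Set Metric Real WithLp
open _root_.MeasureTheory _root_.MeasureTheory.Measure
open scoped ENNReal
open Literature.NumberTheory.Transcendental.KZ (appendMeasurableEquiv
  appendMeasurableEquiv_symm_apply volume_preserving_appendMeasurableEquiv)

namespace Literature.MathematicalPhysics.StatisticalMechanics

namespace HardSphereVirial

/-! ### The lens common to two overlapping unit balls -/

/-- **Volume of the lens of two unit balls at distance `d ≤ 1`** (Boltzmann 1896; the overlap
volume entering `B₃`): for `x ∈ ℝ³` with `|x| = d ≤ 1`,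
`vol(B(0,1) ∩ B(x,1)) = 4π/3 − πd + πd³/12 = π(16 − 12d + d³)/12`.
Proof: for `x = 0` this is the volume of the unit ball; for `x ≠ 0`, in bipolar coordinates
`(r₁, r₂) = (|y|, |y − x|)` (`Tao2016.lintegral_norm_norm_add`) the lens is
`{r₁ < 1, r₂ < 1}`, so `vol = (2π/d) ∫₀¹ r₁ ((min(d+r₁,1))² − (d−r₁)²)/2 dr₁`, and the integral
splits at `r₁ = 1 − d` into `∫₀^{1−d} 2d r₁²` and `∫_{1−d}^1 ((1−d²)r₁ + 2d r₁² − r₁³)/2`.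
[folklore] -/
theorem volume_unitBall_inter_unitBall {x : EuclideanSpace ℝ (Fin 3)} (hx1 : ‖x‖ ≤ 1) :
    volume (ball (0 : EuclideanSpace ℝ (Fin 3)) 1 ∩ ball x 1) =
      ENNReal.ofReal (π * (16 - 12 * ‖x‖ + ‖x‖ ^ 3) / 12) := by
  rcases eq_or_ne x 0 with rfl | hx0
  · rw [inter_self, EuclideanSpace.volume_ball_fin_three, norm_zero, ENNReal.ofReal_one, one_pow,
      one_mul]
    congr 1
    ring
  set d : ℝ := ‖x‖ with hd
  have hd0 : 0 < d := norm_pos_iff.mpr hx0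
  -- the indicator of the lens as a function of the two distances `|y|`, `|y - x|`
  set Φ : ℝ → ℝ → ℝ≥0∞ := fun r₁ r₂ => if r₁ < 1 then (if r₂ < 1 then 1 else 0) else 0 with hΦ
  have hΦm : Measurable (Function.uncurry Φ) := by
    rw [hΦ]
    exact Measurable.ite (measurableSet_lt measurable_fst measurable_const)
      (Measurable.ite (measurableSet_lt measurable_snd measurable_const) measurable_const
        measurable_const) measurable_const
  have h1 : volume (ball (0 : EuclideanSpace ℝ (Fin 3)) 1 ∩ ball x 1) =
      ∫⁻ y : EuclideanSpace ℝ (Fin 3), Φ ‖y‖ ‖y + -x‖ := by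
    rw [← lintegral_indicator_one (measurableSet_ball.inter measurableSet_ball)]
    refine lintegral_congr fun y => ?_
    rw [hΦ, ← sub_eq_add_neg]
    by_cases h₁ : ‖y‖ < 1 <;> by_cases h₂ : ‖y - x‖ < 1 <;>
      simp [mem_ball, dist_eq_norm, h₁, h₂]
  rw [h1, Literature.Analysis.FluidPDE.Tao2016.lintegral_norm_norm_add (neg_ne_zero.mpr hx0) Φ hΦm,
    norm_neg, ← hd]
  -- the inner integral over `r₂ ∈ (|d - r₁|, min (d + r₁) 1)`
  have hinner : ∀ r₁ ∈ Ioi (0 : ℝ),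
      ∫⁻ r₂ in Ioo |d - r₁| (d + r₁), ENNReal.ofReal (r₁ * r₂) * Φ r₁ r₂ =
        (Iio 1).indicator
          (fun r₁ => ENNReal.ofReal (r₁ * ((min (d + r₁) 1) ^ 2 - (d - r₁) ^ 2) / 2)) r₁ := by
    intro r₁ hr₁
    rw [mem_Ioi] at hr₁
    by_cases h₁ : r₁ < 1
    · rw [indicator_of_mem (mem_Iio.mpr h₁)]
      have h2 : ∀ r₂, ENNReal.ofReal (r₁ * r₂) * Φ r₁ r₂ =
          (Iio 1).indicator (fun r₂ => ENNReal.ofReal (r₁ * r₂)) r₂ := by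
        intro r₂
        rw [hΦ]
        by_cases h : r₂ < 1
        · simp [h, h₁]
        · simp [h, h₁]
      simp_rw [h2]
      rw [lintegral_indicator measurableSet_Iio, Measure.restrict_restrict measurableSet_Iio,
        Set.inter_comm (Iio (1 : ℝ)), Ioo_inter_Iio,
        Literature.MeasureTheory.Lebesgue.setLIntegral_Ioo_ofReal_const_mul hr₁.le (abs_nonneg _)
          (le_min (by linarith) zero_le_one), sq_abs]
    · rw [indicator_of_notMem (fun h : r₁ ∈ Iio 1 => h₁ h)]
      have h2 : ∀ r₂, ENNReal.ofReal (r₁ * r₂) * Φ r₁ r₂ = 0 := by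
        intro r₂
        rw [hΦ]
        simp [h₁]
      simp_rw [h2]
      rw [lintegral_zero]
  rw [setLIntegral_congr_fun measurableSet_Ioi hinner, lintegral_indicator measurableSet_Iio,
    Measure.restrict_restrict measurableSet_Iio, Set.inter_comm (Iio (1 : ℝ)), Ioi_inter_Iio]
  -- pass to a real integral over `(0, 1)`
  have hgc : Continuous fun r₁ : ℝ => r₁ * ((min (d + r₁) 1) ^ 2 - (d - r₁) ^ 2) / 2 := by
    fun_prop
  have hg0 : ∀ r₁ ∈ Icc (0 : ℝ) 1, 0 ≤ r₁ * ((min (d + r₁) 1) ^ 2 - (d - r₁) ^ 2) / 2 := by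
    intro r₁ hr₁
    have hmin : (d - r₁) ^ 2 ≤ (min (d + r₁) 1) ^ 2 := by
      rcases le_total (d + r₁) 1 with h | h
      · rw [min_eq_left h]
        nlinarith [hr₁.1, hd0.le]
      · rw [min_eq_right h, one_pow]
        have hle : |d - r₁| ≤ 1 := abs_le.mpr ⟨by linarith [hr₁.2], by linarith [hr₁.1]⟩
        have h' : |d - r₁| ^ 2 ≤ 1 ^ 2 := pow_le_pow_left₀ (abs_nonneg _) hle 2
        rw [sq_abs, one_pow] at h'
        exact h'
    have : 0 ≤ r₁ * ((min (d + r₁) 1) ^ 2 - (d - r₁) ^ 2) := mul_nonneg hr₁.1 (by linarith)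
    linarith
  have hint : IntegrableOn (fun r₁ : ℝ => r₁ * ((min (d + r₁) 1) ^ 2 - (d - r₁) ^ 2) / 2)
      (Ioo 0 1) := (hgc.integrableOn_Icc).mono_set Ioo_subset_Icc_self
  have hnn : 0 ≤ᵐ[volume.restrict (Ioo (0 : ℝ) 1)]
      fun r₁ : ℝ => r₁ * ((min (d + r₁) 1) ^ 2 - (d - r₁) ^ 2) / 2 := by
    rw [Filter.EventuallyLE, ae_restrict_iff' measurableSet_Ioo]
    exact Filter.Eventually.of_forall fun r hr => hg0 r (Ioo_subset_Icc_self hr)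
  rw [← ofReal_integral_eq_lintegral_ofReal hint hnn, ← integral_Ioc_eq_integral_Ioo,
    ← intervalIntegral.integral_of_le zero_le_one, ← ENNReal.ofReal_mul (by positivity)]
  congr 1
  -- split the `r₁`-integral at `1 - d`
  have hd1 : 0 ≤ 1 - d := by linarith
  rw [← intervalIntegral.integral_add_adjacent_intervals (b := 1 - d)
    (hgc.intervalIntegrable _ _) (hgc.intervalIntegrable _ _)]
  have hleft : ∫ r in (0 : ℝ)..(1 - d), r * ((min (d + r) 1) ^ 2 - (d - r) ^ 2) / 2 =
      ∫ r in (0 : ℝ)..(1 - d), 2 * d * r ^ 2 := by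
    refine intervalIntegral.integral_congr fun r hr => ?_
    rw [uIcc_of_le hd1] at hr
    rw [min_eq_left (by linarith [hr.2])]
    ring
  have hright : ∫ r in (1 - d)..1, r * ((min (d + r) 1) ^ 2 - (d - r) ^ 2) / 2 =
      ∫ r in (1 - d)..1, ((1 - d ^ 2) * r + 2 * d * r ^ 2 - r ^ 3) / 2 := by
    refine intervalIntegral.integral_congr fun r hr => ?_
    rw [uIcc_of_le (by linarith : 1 - d ≤ 1)] at hr
    rw [min_eq_right (by linarith [hr.1])]
    ring
  have hdne : d ≠ 0 := hd0.ne'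
  rw [hleft, hright, intervalIntegral.integral_const_mul, integral_pow,
    intervalIntegral.integral_div, intervalIntegral.integral_sub, intervalIntegral.integral_add,
    intervalIntegral.integral_const_mul, intervalIntegral.integral_const_mul, integral_id,
    integral_pow, integral_pow]
  · field_simp
    ring
  all_goals
    apply Continuous.intervalIntegrable
    fun_prop

/-! ### The triangle domain in `ℝ³ × ℝ³` -/

/-- **`vol{(x, y) ∈ ℝ³ × ℝ³ : |x| < 1, |y| < 1, |x − y| < 1} = 5π²/6`** (Boltzmann's
`B₃ = (5/8)B₂²`, volume form): Fubini over `x`, whose slice is the lens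
`B(0,1) ∩ B(x,1)` for `|x| < 1` and empty otherwise, then the radial formula
`∫_{ℝ³} g(|x|) dx = ∫₀^∞ 4πw² g(w) dw`: `4π·(π/12)∫₀¹ w²(16 − 12w + w³) dw = (π²/3)(5/2)`.
[folklore] -/
theorem volume_triangleProd :
    volume {p : EuclideanSpace ℝ (Fin 3) × EuclideanSpace ℝ (Fin 3) |
        ‖p.1‖ < 1 ∧ ‖p.2‖ < 1 ∧ ‖p.1 - p.2‖ < 1} = ENNReal.ofReal (5 * π ^ 2 / 6) := by
  set T : Set (EuclideanSpace ℝ (Fin 3) × EuclideanSpace ℝ (Fin 3)) :=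
    {p | ‖p.1‖ < 1 ∧ ‖p.2‖ < 1 ∧ ‖p.1 - p.2‖ < 1} with hT
  have hTm : MeasurableSet T :=
    (measurableSet_lt measurable_fst.norm measurable_const).inter
      ((measurableSet_lt measurable_snd.norm measurable_const).inter
        (measurableSet_lt (measurable_fst.sub measurable_snd).norm measurable_const))
  rw [show (volume : Measure (EuclideanSpace ℝ (Fin 3) × EuclideanSpace ℝ (Fin 3))) =
      volume.prod volume from rfl, Measure.prod_apply hTm]
  -- the slices
  have hslice : ∀ x : EuclideanSpace ℝ (Fin 3), volume (Prod.mk x ⁻¹' T) =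
      if ‖x‖ < 1 then ENNReal.ofReal (π * (16 - 12 * ‖x‖ + ‖x‖ ^ 3) / 12) else 0 := by
    intro x
    by_cases hx : ‖x‖ < 1
    · rw [if_pos hx]
      have hset : Prod.mk x ⁻¹' T = ball 0 1 ∩ ball x 1 := by
        ext y
        simp only [hT, mem_preimage, mem_setOf_eq, mem_inter_iff, mem_ball, dist_eq_norm, sub_zero,
          norm_sub_rev x y]
        exact ⟨fun h => ⟨h.2.1, h.2.2⟩, fun h => ⟨hx, h.1, h.2⟩⟩
      rw [hset, volume_unitBall_inter_unitBall hx.le]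
    · rw [if_neg hx]
      have hset : Prod.mk x ⁻¹' T = ∅ := by
        ext y
        simp only [hT, mem_preimage, mem_setOf_eq, mem_empty_iff_false, iff_false, not_and]
        exact fun h => absurd h hx
      rw [hset, measure_empty]
  simp_rw [hslice]
  -- radial integration
  set G : ℝ → ℝ≥0∞ := fun r =>
    if r < 1 then ENNReal.ofReal (π * (16 - 12 * r + r ^ 3) / 12) else 0 with hG
  have hGm : Measurable G := by
    rw [hG]
    exact Measurable.ite measurableSet_Iio (by fun_prop) measurable_const
  rw [show (fun x : EuclideanSpace ℝ (Fin 3) =>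
      if ‖x‖ < 1 then ENNReal.ofReal (π * (16 - 12 * ‖x‖ + ‖x‖ ^ 3) / 12) else 0) =
      fun x => G ‖x‖ from rfl,
    Literature.MeasureTheory.Lebesgue.lintegral_radial_three G hGm]
  have hcomb : ∀ w ∈ Ioi (0 : ℝ), ENNReal.ofReal (4 * π * w ^ 2) * G w =
      (Iio 1).indicator
        (fun w => ENNReal.ofReal (4 * π * w ^ 2 * (π * (16 - 12 * w + w ^ 3) / 12))) w := by
    intro w _
    rw [hG]
    by_cases h1 : w < 1
    · rw [indicator_of_mem (mem_Iio.mpr h1)]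
      simp only [h1, if_true]
      rw [← ENNReal.ofReal_mul (by positivity)]
    · rw [indicator_of_notMem (fun h : w ∈ Iio 1 => h1 h)]
      simp [h1]
  rw [setLIntegral_congr_fun measurableSet_Ioi hcomb, lintegral_indicator measurableSet_Iio,
    Measure.restrict_restrict measurableSet_Iio, Set.inter_comm (Iio (1 : ℝ)), Ioi_inter_Iio]
  have hint : IntegrableOn (fun w : ℝ => 4 * π * w ^ 2 * (π * (16 - 12 * w + w ^ 3) / 12))
      (Ioo 0 1) := (Continuous.integrableOn_Icc (by fun_prop)).mono_set Ioo_subset_Icc_self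
  have hnn : 0 ≤ᵐ[volume.restrict (Ioo (0 : ℝ) 1)]
      fun w : ℝ => 4 * π * w ^ 2 * (π * (16 - 12 * w + w ^ 3) / 12) := by
    rw [Filter.EventuallyLE, ae_restrict_iff' measurableSet_Ioo]
    refine Filter.Eventually.of_forall fun w hw => ?_
    have h16 : 0 ≤ 16 - 12 * w + w ^ 3 := by
      have h3 : 0 ≤ w ^ 3 := pow_nonneg hw.1.le 3
      linarith [hw.2]
    exact mul_nonneg (by positivity) (div_nonneg (mul_nonneg pi_pos.le h16) (by norm_num))
  rw [← ofReal_integral_eq_lintegral_ofReal hint hnn, ← integral_Ioc_eq_integral_Ioo,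
    ← intervalIntegral.integral_of_le zero_le_one]
  congr 1
  have e : ∀ w : ℝ, 4 * π * w ^ 2 * (π * (16 - 12 * w + w ^ 3) / 12) =
      π ^ 2 / 3 * (16 * w ^ 2 - 12 * w ^ 3 + w ^ 5) := fun w => by ring
  simp_rw [e]
  rw [intervalIntegral.integral_const_mul, intervalIntegral.integral_add,
    intervalIntegral.integral_sub, intervalIntegral.integral_const_mul,
    intervalIntegral.integral_const_mul, integral_pow, integral_pow, integral_pow]
  · ring
  all_goals
    apply Continuous.intervalIntegrable
    fun_prop

/-! ### Transfer to `Fin 6 → ℝ` and the discharge -/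

/-- `‖toLp 2 f‖ < 1 ↔ f 0² + f 1² + f 2² < 1` for `f : Fin 3 → ℝ`. [folklore] -/
theorem norm_toLp_lt_one_iff (f : Fin 3 → ℝ) :
    ‖(toLp 2 f : EuclideanSpace ℝ (Fin 3))‖ < 1 ↔ f 0 ^ 2 + f 1 ^ 2 + f 2 ^ 2 < 1 := by
  rw [← sq_lt_one_iff₀ (norm_nonneg _), EuclideanSpace.real_norm_sq_eq, Fin.sum_univ_three]

/-- **`vol(triangleSphere) = 5π²/6`**: the Mayer triangle domain of hard spheres
(`|x₂|, |x₃|, |x₂ − x₃| < 1` in `ℝ⁶`, `HardSphereVirialCoefficients.lean`) is the preimage of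
the domain of `volume_triangleProd` under the volume-preserving map
`ℝ⁶ → ℝ³ × ℝ³`, `z ↦ (z|₃, z|³)` (`KZ.appendMeasurableEquiv`, `PiLp.volume_preserving_toLp`).
[folklore] -/
theorem volume_triangleSphere : volume triangleSphere = ENNReal.ofReal (5 * π ^ 2 / 6) := by
  set Ψ : (Fin 6 → ℝ) → EuclideanSpace ℝ (Fin 3) × EuclideanSpace ℝ (Fin 3) :=
    (Prod.map (toLp 2) (toLp 2) : (Fin 3 → ℝ) × (Fin 3 → ℝ) →
        EuclideanSpace ℝ (Fin 3) × EuclideanSpace ℝ (Fin 3)) ∘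
      ((appendMeasurableEquiv 3 3).symm : (Fin 6 → ℝ) → (Fin 3 → ℝ) × (Fin 3 → ℝ)) with hΨ
  have hmp : MeasurePreserving Ψ volume volume :=
    ((PiLp.volume_preserving_toLp (Fin 3)).prod (PiLp.volume_preserving_toLp (Fin 3))).comp
      (volume_preserving_appendMeasurableEquiv (n := 3) (m := 3)).symm
  have hpre : Ψ ⁻¹' {p : EuclideanSpace ℝ (Fin 3) × EuclideanSpace ℝ (Fin 3) |
      ‖p.1‖ < 1 ∧ ‖p.2‖ < 1 ∧ ‖p.1 - p.2‖ < 1} = triangleSphere := by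
    ext z
    simp only [hΨ, mem_preimage, Function.comp_apply, appendMeasurableEquiv_symm_apply,
      Prod.map_apply, mem_setOf_eq, ← toLp_sub, norm_toLp_lt_one_iff, Pi.sub_apply,
      triangleSphere]
    exact Iff.rfl
  have hms : MeasurableSet {p : EuclideanSpace ℝ (Fin 3) × EuclideanSpace ℝ (Fin 3) |
      ‖p.1‖ < 1 ∧ ‖p.2‖ < 1 ∧ ‖p.1 - p.2‖ < 1} :=
    (measurableSet_lt measurable_fst.norm measurable_const).inter
      ((measurableSet_lt measurable_snd.norm measurable_const).inter
        (measurableSet_lt (measurable_fst.sub measurable_snd).norm measurable_const))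
  rw [← hpre, hmp.measure_preimage hms.nullMeasurableSet, volume_triangleProd]

/-- **`B₃` of hard spheres (Boltzmann 1896): `B₃/B₂² = 5/8`**, i.e.
`(1/3)·vol(triangleSphere) = (5/8)·(2π/3)²` — discharge of the named fact `hardSphere_B3`, the
`D = 3` case of the printed formula
`B₃/B₂² = 4Γ(1+D/2)/(π^{1/2}Γ((1+D)/2)) ∫₀^{π/3} sin^D φ dφ` with `B₂ = π^{D/2}/(2Γ(D/2+1))`,
`σ = 1`, `B₃ = −(1/3)∫∫f f f`, `f = −𝟙_{r<1}` [Lyberg 2005, §1]; proved through the lens volume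
(`volume_unitBall_inter_unitBall`) and `volume_triangleSphere`.
[cite: Lyberg2005, §1 (B₃/B₂² formula, D = 3)] -/
theorem hardSphere_B3_holds : hardSphere_B3 := by
  unfold hardSphere_B3
  rw [volume_triangleSphere, ENNReal.toReal_ofReal (by positivity)]
  ring

/-- **`B₄` of hard spheres (Boltzmann 1899, van Laar 1899, Nijboer–van Hove 1952):
`B₄/B₂³ = 2707/4480 + (219/2240)(√2/π) − (4131/4480)(arccos(1/3)/π)`**, in the Mayer form
`B₄ = −(1/8)(3·vol(ringSphere) − 6·vol(diamondSphere) + vol(starSphere))`, `B₂ = 2π/3` —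
discharge of the named fact `hardSphere_B4`. It is the tree's
`Boltzmann1899_B4_hardSpheres_dim3_holds` (the same three volumes, computed in
`BoltzmannB4HardSpheresProofs` / `BoltzmannB4HardSpheresFinal` by Lyberg's two-centre reduction),
multiplied through by `(2π/3)³`; the sets `hardSphereRingFour`, `hardSphereDiamondFour`,
`hardSphereStarFour` of that file are definitionally `ringSphere`, `diamondSphere`, `starSphere`.
[cite: Lyberg2005, §1 (display after (12): "Boltzmann's result", confirmed by Nijboer–van Hove)] -/
theorem hardSphere_B4_holds : hardSphere_B4 := by
  have h := Boltzmann1899_B4_hardSpheres_dim3_holds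
  rw [Boltzmann1899_B4_hardSpheres_dim3_iff] at h
  have hR : hardSphereRingFour = ringSphere := rfl
  have hD : hardSphereDiamondFour = diamondSphere := rfl
  have hS : hardSphereStarFour = starSphere := rfl
  rw [hR, hD, hS, div_eq_iff (by positivity)] at h
  unfold hardSphere_B4
  linear_combination h

/-! ### Hard discs: `B₄` (Rowlinson 1964, Hemmer 1964) -/

/-- The hard-disc Mayer ring domain of `HardSphereVirialCoefficients.lean` is, verbatim, the set
`hardDiscRing` of `HardDiscVirial.lean`. [folklore] -/
theorem ringDisc_eq_hardDiscRing : ringDisc = hardDiscRing := rfl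

/-- The hard-disc Mayer diamond domain of `HardSphereVirialCoefficients.lean` is the set
`hardDiscDiamond` of `HardDiscVirial.lean` (the same five strict unit-distance constraints, listed
in a different order). [folklore] -/
theorem diamondDisc_eq_hardDiscDiamond : diamondDisc = hardDiscDiamond := by
  ext x
  simp only [diamondDisc, hardDiscDiamond, Set.mem_setOf_eq]
  tauto

/-- The hard-disc Mayer complete-star domain of `HardSphereVirialCoefficients.lean` is, verbatim,
the set `hardDiscStar` of `HardDiscVirial.lean`. [folklore] -/
theorem starDisc_eq_hardDiscStar : starDisc = hardDiscStar := rfl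

/-- **Volume of the hard-disc complete star Mayer domain** (Rowlinson 1964, Hemmer 1964):
`vol(starDisc) = π³ − (3√3/2)π² + π`, transported along `starDisc_eq_hardDiscStar` from
`HardDiscB4Volume.volume_hardDiscStar_toReal` (`HardDiscVirialB4Proofs.lean`).
[cite: ClisbyMccoy2004, §1 (Mayer expansion of B₄ and its D = 2 value)] -/
theorem volume_starDisc_toReal :
    (volume starDisc).toReal = π ^ 3 - 3 * Real.sqrt 3 / 2 * π ^ 2 + π := by
  rw [starDisc_eq_hardDiscStar]
  exact HardDiscB4Volume.volume_hardDiscStar_toReal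

/-- **`B₄` of hard discs (Rowlinson 1964, Hemmer 1964): `B₄/B₂³ = 2 − 9√3/(2π) + 10/π²`**, in
the Mayer form `B₄ = −(1/8)(3·vol(ringDisc) − 6·vol(diamondDisc) + vol(starDisc))`, `B₂ = π/2` —
discharge of the named fact `hardDisc_B4`. It is the tree's `ClisbyMcCoy2004_B4_hardDiscs_holds`
(`HardDiscVirialB4Proofs.lean`: `V(C₄) = π³ − 16π/3`, `V(◇) = π³ − √3π² − 5π/6`,
`V(K₄) = π³ − (3√3/2)π² + π`) multiplied through by `(π/2)³`, the three configuration sets being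
identified by `ringDisc_eq_hardDiscRing`, `diamondDisc_eq_hardDiscDiamond`, `starDisc_eq_hardDiscStar`.
[cite: ClisbyMccoy2004, §1 (display B₄/B₂³ for D = 2 and the Mayer expansion of B₄)] -/
theorem hardDisc_B4_holds : hardDisc_B4 := by
  have h := ClisbyMcCoy2004_B4_hardDiscs_holds
  unfold ClisbyMcCoy2004_B4_hardDiscs at h
  rw [← ringDisc_eq_hardDiscRing, ← diamondDisc_eq_hardDiscDiamond, ← starDisc_eq_hardDiscStar,
    div_eq_iff (by positivity)] at h
  unfold hardDisc_B4
  linear_combination h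

end HardSphereVirial

end Literature.MathematicalPhysics.StatisticalMechanics

end
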